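import Literature.Geometry.Symplectic.SteinDomainSublevel
import Literature.Geometry.Symplectic.TwoHandleIsotopyFraming
import HarnessLib

/-!
# The contact data of the boundary of a shrunk Stein domain, read in the ambient domain

Topic `Literature/Geometry/Symplectic`; proofs file of the fact seat of
`Literature.Geometry.Symplectic.Gompf1998_thm13_twoHandles` (**E2**, `SteinTwoHandles.lean`),
step "Gray transport along the levels of `φ`".  `SteinDomainSublevel.lean` gives the high
sublevel set `W_c = {φ ≤ c}` of a compact Stein `(W, J, φ)` its restricted Stein structure
`S.sublevel` (`J^c = (Dι)⁻¹ J Dι`, `φ ∘ ι`).  This file is the **dictionary** expressing the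
contact-geometric notions of `SteinBoundaryContact.lean` for `(W_c, S.sublevel)` — the tangent
hyperplane of `∂W_c = {φ = c}`, the complex tangencies `ξ`, the contact form `α`, the Kähler form
`ω`, the twisting loop of a framed knot — through the differential `Dι` of the inclusion
(`RegularDomain.valDeriv`) in terms of the same notions of `(W, S)` at the points of the level
`{φ = c}`:

* `sublevel_dφ_apply`, `sublevel_contactForm_apply`, `sublevel_kahlerForm_apply` —
  `dφ^c = dφ ∘ Dι`, `α^c = α ∘ Dι`, `ω^c = ω ∘ (Dι × Dι)` (naturality of `d`);
* `sublevel_apply_zero_iff`, `sublevel_mem_contactPlane_iff` — a vector of `W_c` at a boundary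
  point is tangent to `∂W_c` iff `dφ(Dι v) = 0`, and lies in `ξ^c` iff moreover `α(Dι v) = 0`;
* `sublevel_twistingLoop` — the twisting loop of a framed knot in `∂W_c` is
  `t ↦ (ω(Dι ċ, Dι ν), α(Dι ν))`, and `valDeriv_knotVelocity` — `Dι ċ = (ι ∘ K)˙`;

and general plumbing for knots and framings pushed forward along a diffeomorphism *between two*
manifolds with boundary (`TwoHandleIsotopyFraming.lean` has the self-diffeomorphism case):
`knotVelocity_comp'`, `IsBoundaryKnot.comp_diffeomorph'`, `IsKnotFraming.pushforward'`.
Everything is **proved**; no named fact.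

## References

* K. Cieliebak, Ya. Eliashberg, *From Stein to Weinstein and Back*, AMS Colloquium Publ. 59
  (2012), Def. 1.1 ff. and §2 (regular sublevel sets of `J`-convex functions and their contact
  boundaries). [CieliebakEliashberg2012]
* R. E. Gompf, *Handlebody construction of Stein surfaces*, Ann. of Math. 148 (1998), §1
  (Legendrian knots, canonical framing, twisting). [Gompf1998]
-/

noncomputable section

open scoped Manifold ContDiff Topology Bundle
open Set Function Bundle Filter

namespace Literature.Geometry.Symplectic

open Literature.Geometry.Kaehler Literature.Topology.FourManifolds

/-! ### Knots and framings pushed forward along a diffeomorphism of two manifolds -/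

section Pushforward

variable {W : Type*} [TopologicalSpace W] [ChartedSpace (EuclideanHalfSpace 4) W]
  [IsManifold (𝓡∂ 4) ∞ W] {M' : Type*} [TopologicalSpace M'] [ChartedSpace (EuclideanHalfSpace 4) M']
  [IsManifold (𝓡∂ 4) ∞ M']

omit [IsManifold (𝓡∂ 4) ∞ W] [IsManifold (𝓡∂ 4) ∞ M'] in
/-- **Chain rule for the knot velocity** along a map to another manifold:
`(F ∘ K)˙(t) = dF (K̇(t))`. [folklore] -/
theorem knotVelocity_comp' {K : (Metric.sphere (0 : EuclideanSpace ℝ (Fin 2)) 1) → W} {F : W → M'} (hF : MDifferentiable (𝓡∂ 4) (𝓡∂ 4) F)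
    (hK : MDifferentiable (𝓡 1) (𝓡∂ 4) K) (t : ℝ) :
    knotVelocity (F ∘ K) t = mfderiv (𝓡∂ 4) (𝓡∂ 4) F (K (circlePt t)) (knotVelocity K t) := by
  have hc : MDifferentiableAt 𝓘(ℝ, ℝ) (𝓡∂ 4) (K ∘ circlePt) t :=
    (hK _).comp t (contMDiff_circlePt.mdifferentiableAt (by simp))
  unfold knotVelocity
  rw [show (F ∘ K) ∘ circlePt = F ∘ (K ∘ circlePt) from rfl, mfderiv_comp t (hF _) hc]
  rfl

/-- **A knot in the boundary pushed forward by a diffeomorphism onto another manifold is a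
knot in the boundary** (diffeomorphisms preserve boundary points). [folklore] -/
theorem IsBoundaryKnot.comp_diffeomorph' {K : (Metric.sphere (0 : EuclideanSpace ℝ (Fin 2)) 1) → W} (hK : IsBoundaryKnot K)
    (F : W ≃ₘ⟮𝓡∂ 4, 𝓡∂ 4⟯ M') : IsBoundaryKnot (F ∘ K) where
  isSmoothEmbedding := hK.isSmoothEmbedding.diffeomorph_comp F
  isBoundaryPoint u := by
    have : F (K u) ∈ F '' (𝓡∂ 4).boundary W := mem_image_of_mem _ (hK.isBoundaryPoint u)
    rw [Diffeomorph.image_boundary (by simp) F] at this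
    exact this

/-- **Diffeomorphisms onto another manifold push framings forward**: if `ν` is a framing of the
knot `K` in `∂W` and `F : W ≅ M'` a diffeomorphism, `u ↦ dF_{K u}(ν u)` is a framing of `F ∘ K`
in `∂M'` (continuity of the tangent map; `Diffeomorph.mfderiv_apply_zero`; injectivity of
`dF`). [folklore] -/
theorem IsKnotFraming.pushforward' {K : (Metric.sphere (0 : EuclideanSpace ℝ (Fin 2)) 1) → W} {ν : (Metric.sphere (0 : EuclideanSpace ℝ (Fin 2)) 1) → EuclideanSpace ℝ (Fin 4)} (hK : IsBoundaryKnot K)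
    (hν : IsKnotFraming K ν) (F : W ≃ₘ⟮𝓡∂ 4, 𝓡∂ 4⟯ M') :
    IsKnotFraming (F ∘ K) fun u => mfderiv (𝓡∂ 4) (𝓡∂ 4) F (K u) (ν u) where
  continuous := by
    have h1 : Continuous (tangentMap (𝓡∂ 4) (𝓡∂ 4) F) := F.contMDiff.continuous_tangentMap (by simp)
    exact h1.comp hν.continuous
  mem_boundaryTangentSpace u :=
    (mem_boundaryTangentSpace_iff _).2 (Diffeomorph.mfderiv_apply_zero F (hK.isBoundaryPoint u)
      ((mem_boundaryTangentSpace_iff _).1 (hν.mem_boundaryTangentSpace u)))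
  not_mem_span t := by
    have hFd : MDifferentiable (𝓡∂ 4) (𝓡∂ 4) F := fun x => (F.contMDiff x).mdifferentiableAt (by simp)
    have hKd : MDifferentiable (𝓡 1) (𝓡∂ 4) K := fun u =>
      (hK.isSmoothEmbedding.contMDiff u).mdifferentiableAt (by simp)
    rw [knotVelocity_comp' hFd hKd, Submodule.mem_span_singleton]
    rintro ⟨c, hc⟩
    have hinj : Injective (mfderiv (𝓡∂ 4) (𝓡∂ 4) F (K (circlePt t))) := fun a b hab =>
      (Diffeomorph.mfderivToContinuousLinearEquiv F (by simp) (K (circlePt t))).injective hab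
    exact hν.not_mem_span t (Submodule.mem_span_singleton.2
      ⟨c, hinj ((ContinuousLinearMap.map_smul _ c _).trans hc)⟩)

end Pushforward

/-! ### The contact data of `∂W_c` through `Dι` -/

namespace SteinStructure

variable {W : Type*} [TopologicalSpace W] [T2Space W] [ChartedSpace (EuclideanHalfSpace 4) W]
  [IsManifold (𝓡∂ 4) ∞ W] [CompactSpace W] (S : SteinStructure W) {c : ℝ}
  (hc : c < sSup (range S.φ)) (hreg : ∀ x, c ≤ S.φ x → mfderiv (𝓡∂ 4) 𝓘(ℝ, ℝ) S.φ x ≠ 0)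
  (hne : ∃ x, S.φ x = c)

/-- **`dφ^c = dφ ∘ Dι`** for the restricted structure. [folklore] -/
theorem sublevel_dφ_apply (p : ↥(S.φ ⁻¹' Iic c)) (v : EuclideanSpace ℝ (Fin 4)) :
    letI := (S.subAtlas hc hreg).chartedSpace
    haveI := (S.subAtlas hc hreg).isManifold
    haveI := S.compactSpace_sublevel (c := c)
    (S.sublevel hc hreg hne).dφ p v = S.dφ p.1 (RegularDomain.valDeriv (S.subAtlas hc hreg) rfl p v) :=
  S.mfderiv_subφ_apply hc hreg p v

/-- **`α^c = α ∘ Dι`**: the contact form of the restricted structure is the ambient contact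
form on `Dι`-images (`J^c = (Dι)⁻¹ J Dι`). [cite: CieliebakEliashberg2012, Def. 1.1 ff.] -/
theorem sublevel_contactForm_apply (p : ↥(S.φ ⁻¹' Iic c)) (v : EuclideanSpace ℝ (Fin 4)) :
    letI := (S.subAtlas hc hreg).chartedSpace
    haveI := (S.subAtlas hc hreg).isManifold
    haveI := S.compactSpace_sublevel (c := c)
    (S.sublevel hc hreg hne).contactForm p v =
      S.contactForm p.1 (RegularDomain.valDeriv (S.subAtlas hc hreg) rfl p v) := by
  letI := (S.subAtlas hc hreg).chartedSpace
  haveI := (S.subAtlas hc hreg).isManifold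
  haveI := S.compactSpace_sublevel (c := c)
  rw [contactForm_apply, contactForm_apply, S.sublevel_dφ_apply hc hreg hne, S.sublevel_J_apply hc hreg hne,
    ContinuousLinearEquiv.apply_symm_apply]

/-- **`ω^c = ω ∘ (Dι × Dι)`**: the Kähler form of the restricted structure is the ambient one on
`Dι`-images (naturality of the tree's `d`, `mextDeriv_pullback_apply`, with
`d^ℂ(φ ∘ ι) = ι^*(d^ℂφ)`, `dComplex_sub_eq_pullback`). [cite: CieliebakEliashberg2012, Def. 1.1 ff.] -/
theorem sublevel_kahlerForm_apply (p : ↥(S.φ ⁻¹' Iic c)) (v w : EuclideanSpace ℝ (Fin 4)) :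
    letI := (S.subAtlas hc hreg).chartedSpace
    haveI := (S.subAtlas hc hreg).isManifold
    haveI := S.compactSpace_sublevel (c := c)
    (S.sublevel hc hreg hne).kahlerForm p v w =
      S.kahlerForm p.1 (RegularDomain.valDeriv (S.subAtlas hc hreg) rfl p v)
        (RegularDomain.valDeriv (S.subAtlas hc hreg) rfl p w) := by
  letI := (S.subAtlas hc hreg).chartedSpace
  haveI := (S.subAtlas hc hreg).isManifold
  haveI := S.compactSpace_sublevel (c := c)
  have hf : ∀ᶠ z in 𝓝 p, ContMDiffAt (𝓡∂ 4) (𝓡∂ 4) ∞ (Subtype.val : ↥(S.φ ⁻¹' Iic c) → W) z :=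
    Eventually.of_forall fun z => RegularDomain.contMDiff_val (S.subAtlas hc hreg) rfl z
  have hβ : Kaehler.MForm.SmoothAt (dComplex S.J S.φ) (p : W) := S.isSmoothForm_dComplex p.1
  show -(Kaehler.mextDeriv (dComplex (S.sublevel hc hreg hne).J (S.sublevel hc hreg hne).φ) p ![v, w]) =
    -(Kaehler.mextDeriv (dComplex S.J S.φ) p.1 ![_, _])
  have hJφ : dComplex (S.sublevel hc hreg hne).J (S.sublevel hc hreg hne).φ =
      dComplex (S.subJ hc hreg) (S.subφ c) := rfl
  rw [hJφ, S.dComplex_sub_eq_pullback hc hreg, Kaehler.mextDeriv_pullback_apply hf hβ,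
    Kaehler.MForm.pullback_apply]
  congr 2
  funext i
  fin_cases i
  · exact (RegularDomain.valDeriv_apply (S.subAtlas hc hreg) rfl p v).symm
  · exact (RegularDomain.valDeriv_apply (S.subAtlas hc hreg) rfl p w).symm

omit [T2Space W] in
/-- The boundary of `W_c` is the level `{φ = c}`. [folklore] -/
theorem sublevel_isBoundaryPoint_iff (p : ↥(S.φ ⁻¹' Iic c)) :
    letI := (S.subAtlas hc hreg).chartedSpace
    (𝓡∂ 4).IsBoundaryPoint p ↔ S.φ p.1 = c := by
  letI := (S.subAtlas hc hreg).chartedSpace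
  exact isBoundaryPoint_sublevel_iff (k := 3) S.φ_smooth c _ _ p

include hne in
/-- **Tangency to `∂W_c`**: at a boundary point `p` of `W_c`, a vector `v` (read in the chart of
`W_c` at `p`) is tangent to `∂W_c` (`v 0 = 0`) iff `dφ(Dι v) = 0`. [folklore] -/
theorem sublevel_apply_zero_iff {p : ↥(S.φ ⁻¹' Iic c)}
    (hp : letI := (S.subAtlas hc hreg).chartedSpace; (𝓡∂ 4).IsBoundaryPoint p) (v : EuclideanSpace ℝ (Fin 4)) :
    letI := (S.subAtlas hc hreg).chartedSpace
    v 0 = 0 ↔ S.dφ p.1 (RegularDomain.valDeriv (S.subAtlas hc hreg) rfl p v) = 0 := by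
  letI := (S.subAtlas hc hreg).chartedSpace
  haveI := (S.subAtlas hc hreg).isManifold
  haveI := S.compactSpace_sublevel (c := c)
  rw [← S.sublevel_dφ_apply hc hreg hne, (S.sublevel hc hreg hne).mfderiv_φ_apply_eq_zero_iff hp]

/-- **The complex tangencies of `∂W_c`**: at a boundary point `p` of `W_c`,
`v ∈ ξ^c_p ⇔ dφ(Dι v) = 0 ∧ α(Dι v) = 0`. [cite: CieliebakEliashberg2012, §2] -/
theorem sublevel_mem_contactPlane_iff {p : ↥(S.φ ⁻¹' Iic c)}
    (hp : letI := (S.subAtlas hc hreg).chartedSpace; (𝓡∂ 4).IsBoundaryPoint p) (v : EuclideanSpace ℝ (Fin 4)) :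
    letI := (S.subAtlas hc hreg).chartedSpace
    haveI := (S.subAtlas hc hreg).isManifold
    haveI := S.compactSpace_sublevel (c := c)
    v ∈ contactPlane (S.sublevel hc hreg hne).J p ↔
      S.dφ p.1 (RegularDomain.valDeriv (S.subAtlas hc hreg) rfl p v) = 0 ∧
        S.contactForm p.1 (RegularDomain.valDeriv (S.subAtlas hc hreg) rfl p v) = 0 := by
  letI := (S.subAtlas hc hreg).chartedSpace
  haveI := (S.subAtlas hc hreg).isManifold
  haveI := S.compactSpace_sublevel (c := c)
  rw [(S.sublevel hc hreg hne).contactPlane_eq hp, Submodule.mem_inf, LinearMap.mem_ker,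
    LinearMap.mem_ker, ContinuousLinearMap.coe_coe, ContinuousLinearMap.coe_coe,
    S.sublevel_dφ_apply hc hreg hne, S.sublevel_contactForm_apply hc hreg hne]

/-- **The twisting loop of a framed knot in `∂W_c`, read in `W`**:
`(ω^c(ċ, ν), α^c(ν)) = (ω(Dι ċ, Dι ν), α(Dι ν))`. [cite: Gompf1998, §1] -/
theorem sublevel_twistingLoop (K : (Metric.sphere (0 : EuclideanSpace ℝ (Fin 2)) 1) → ↥(S.φ ⁻¹' Iic c)) (ν : (Metric.sphere (0 : EuclideanSpace ℝ (Fin 2)) 1) → EuclideanSpace ℝ (Fin 4)) (t : ℝ) :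
    letI := (S.subAtlas hc hreg).chartedSpace
    haveI := (S.subAtlas hc hreg).isManifold
    haveI := S.compactSpace_sublevel (c := c)
    (S.sublevel hc hreg hne).twistingLoop K ν t =
      ⟨S.kahlerForm (K (circlePt t)).1
          (RegularDomain.valDeriv (S.subAtlas hc hreg) rfl (K (circlePt t)) (knotVelocity K t))
          (RegularDomain.valDeriv (S.subAtlas hc hreg) rfl (K (circlePt t)) (ν (circlePt t))),
        S.contactForm (K (circlePt t)).1
          (RegularDomain.valDeriv (S.subAtlas hc hreg) rfl (K (circlePt t)) (ν (circlePt t)))⟩ := by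
  letI := (S.subAtlas hc hreg).chartedSpace
  haveI := (S.subAtlas hc hreg).isManifold
  haveI := S.compactSpace_sublevel (c := c)
  rw [twistingLoop_apply, S.sublevel_kahlerForm_apply hc hreg hne, S.sublevel_contactForm_apply hc hreg hne]

omit [T2Space W] in
/-- **`Dι ċ = (ι ∘ K)˙`**: the ambient velocity of a knot of `W_c` is the velocity of the same
knot seen in `W`. [folklore] -/
theorem valDeriv_knotVelocity {K : (Metric.sphere (0 : EuclideanSpace ℝ (Fin 2)) 1) → ↥(S.φ ⁻¹' Iic c)}
    (hK : letI := (S.subAtlas hc hreg).chartedSpace; MDifferentiable (𝓡 1) (𝓡∂ 4) K) (t : ℝ) :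
    letI := (S.subAtlas hc hreg).chartedSpace
    RegularDomain.valDeriv (S.subAtlas hc hreg) rfl (K (circlePt t)) (knotVelocity K t) =
      knotVelocity (Subtype.val ∘ K) t := by
  letI := (S.subAtlas hc hreg).chartedSpace
  haveI := (S.subAtlas hc hreg).isManifold
  have hval : MDifferentiable (𝓡∂ 4) (𝓡∂ 4) (Subtype.val : ↥(S.φ ⁻¹' Iic c) → W) := fun p =>
    (RegularDomain.contMDiff_val (S.subAtlas hc hreg) rfl p).mdifferentiableAt (by simp)
  rw [knotVelocity_comp' hval hK, RegularDomain.valDeriv_apply]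

end SteinStructure

end Literature.Geometry.Symplectic

end
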